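import Literature.NumberTheory.EllipticCurves.FineSelmerResidualCharacterFixed
import Literature.NumberTheory.NumberFields.EquivariantUnramifiedHomClassGroup
import Literature.NumberTheory.EllipticCurves.FineSelmerClassGroupCriterionCyclotomicTower
import Literature.NumberTheory.EllipticCurves.FineSelmerCongruentCurvesNumberFieldProofs
import Literature.NumberTheory.EllipticCurves.ZpExtensionUnramifiedProofs
import Mathlib.NumberTheory.Padics.HeightOneSpectrum
import HarnessLib

/-!
# Conjecture A from the absence of the `E[p]`-part of the class group along the cyclotomic tower
# (Coates–Sujatha 2005 Thm. 3.4, ISOTYPIC form, proved WITHOUT `H²` / Poitou–Tate): door L6 ⟹ (A)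

Topic `NumberTheory/EllipticCurves` (grouping namespace `CoatesSujatha2005`, next to
`FineSelmerClassGroupCriterion*.lean`).  THEOREM-ONLY file (no definition, no named fact, no `sorry`),
written by the literature seat `bsd-potss-conjA-anchor` g17 (cell `bsd-potss`; serves the asides
stmt-BirchSwinnertonDyer-19386 / 19413; closes nothing; neither Conjecture A nor BSD is proved for any
particular curve here — the per-row inputs (c1), (c2*)₀, (c3*) remain hypotheses).

THE ARGUMENT (Coates–Sujatha, Math. Ann. 331 (2005) §3, proof of Thm. 3.4 «`μ(Cl(L_∞)) = 0 ⟹ (A)`»,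
in the `E[p]`-ISOTYPIC form that the cell's door-L6 theorem delivers, and with the `H²`/Poitou–Tate step
replaced by finite-level class field theory).  `K` a number field, `p` odd, `K_∞/K` a `ℤ_p`-extension
with layers `K_n`, `L₀ ⊆ K̄` finite Galois, `L_n = L₀K_n`, `M` a finite `p`-torsion `Γ_K`-module fixed
pointwise by `Γ_{L₀}` (for an elliptic curve: `K = ℚ`, `L₀ = ℚ(E[p])`, `M = E[p]`).  Suppose
`Sel₀(K_∞, M)` (the tree's `GreenbergSelmer.fineSelmerInfty M κ`) is infinite.
(1) [`FineSelmerResidualCharacter*.lean`] There is a non-zero `Γ_K`-INVARIANT «shadow»: a function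
`φ : Γ_K → M`, additive and `Γ_K`-equivariant on `H′ = Gal(K̄/L₀K_∞)`, zero off `H′`, which is the
restriction of a fine Selmer cocycle and therefore kills `H′ ∩ gD_vg⁻¹` for every finite place `v` —
in particular every inertia group `I_𝔓 ∩ H′`.
(2) [`EquivariantUnramifiedDescent{,Open}.lean`, Washington §13.3 with `pM = 0`] For a level `n + 1`
past the totally ramified level, `φ` extends to `ψ : Gal(K̄/L_{n+1}) → M`, additive, `Γ_K`-equivariant,
killing EVERY inertia group, with open kernel `Q`.
(3) [`EquivariantUnramifiedHomClassGroup.lean`, equivariant Artin reciprocity] such a `ψ` vanishes as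
soon as `Hom_{Γ_K}(Cl(L_{n+1}), M) = 0` — which is the OUTPUT of door L6
(`DeoRaySujatha2023.homTrivial_divisionField_cyclotomicTower`).  Contradiction; so `Sel₀(K_∞, M)` is
finite, and for `M = E[p]` over `ℚ_cyc` this is statement (A) by Lim–Sujatha's lemma (tree
`LimSujatha2018.fineSelmerDual_moduleFinite_iff_finite_fineSelmerInfty_torsion`).

## Results

* `finite_fineSelmerInfty_of_forall_equivariantHom_classGroup_eq_zero` — the general statement
  («`Hom_{Γ_K}(Cl(L₀K_n), M) = 0 ∀ n` ⟹ `Sel₀(K_∞, M)` finite»), for a number field `K` with ONE place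
  `v₀` above `p`, totally ramified in `K_∞` (`I_{𝔓₀}·Gal(K̄/K_∞) = Γ_K`).
* `finite_fineSelmerInfty_torsion_of_homTrivial_cyclotomicTower` — `E/ℚ`, `p` odd, `κ` cyclotomic:
  door-L6 output ⟹ `Sel₀(ℚ_∞, E[p])` finite.
* `conjA_of_homTrivial_cyclotomicTower` — … ⟹ statement (A) (`∃ γ D, D.X` f.g. over `ℤ_p`).
* `conjA_of_not_dvd_card_classGroup`, `conjA_of_eigenHom_subfield` (§3 append) — the per-row entry
  points: (A) from «`p ∤ #Cl(𝓞_{ℚ(E[p])})`» resp. from the eigen-test on `Cl(ℚ(P))`, with (c1), (c3) at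
  `p` in the `E[p^∞]`-currency, `κ` cyclotomic.
* **`conjA_of_homTrivial_divisionField`** — DOOR L6 ⟹ (A): `p ∤ #Gal(ℚ(E[p])/ℚ)` (c1), every
  `Γ_ℚ`-equivariant additive `Cl(𝓞_{ℚ(E[p])}) → E[p]` zero (c2*)₀, `E[p]^{D_p} = 0` (c3*), `κ` cyclotomic
  ⟹ (A) for `E` at `p` — the cell's census certificate «(c1) + `E[p] ∉ Cl(ℚ(E[p]))⊗𝔽_p` +
  `E(ℚ_p)[p] = 0`» is now a complete kernel road to (A) modulo NO named fact.

## References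

* J. Coates, R. Sujatha, *Fine Selmer groups of elliptic curves over p-adic Lie extensions*, Math. Ann.
  331 (2005), §3 Thm. 3.4, Lemma 3.8, Cor. 3.6. [CoatesSujatha2005]
* L. C. Washington, *Introduction to Cyclotomic Fields*, 2nd ed., GTM 83 (1997), §13.1 Lemma 13.3,
  §13.3 Lemmas 13.14–13.15, Thm. 10.4. [Washington1997]
* M. F. Lim, R. Sujatha, J. Number Theory 187 (2018), §3 (lemma before Prop. 3.2). [LimSujatha2018]
* S. V. Deo, A. Ray, R. Sujatha, Pure Appl. Math. Q. 19 (2023), §3 Thm. 3.8. [DeoRaySujatha2023]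
-/

noncomputable section

open scoped Classical Pointwise nonZeroDivisors
open NumberField Field IntermediateField IsDedekindDomain WeierstrassCurve
open Literature.NumberTheory.GaloisRepresentations Literature.NumberTheory.NumberFields
open Literature.NumberTheory.EllipticCurves Literature.NumberTheory.EllipticCurves.GreenbergSelmer

namespace Literature.NumberTheory.EllipticCurves.CoatesSujatha2005

universe u

/-! ## §0 Helpers (Galois dictionaries, primes of `ℤ̄_K`) -/

section Helpers

variable {K : Type} [Field K]

/-- `τ|_E = 1` iff `τ ∈ Gal(K̄/E)`. [folklore] -/
private theorem absRestrictNormalHom_eq_one_iff_mem_fixingSubgroup'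
    (E : IntermediateField K (AlgebraicClosure K)) [Normal K E] (τ : absoluteGaloisGroup K) :
    absRestrictNormalHom E τ = 1 ↔ absoluteGaloisGroup.toAlgEquiv K τ ∈ E.fixingSubgroup := by
  have hc : ∀ x : E, ((absRestrictNormalHom E τ x : E) : AlgebraicClosure K) =
      τ • (x : AlgebraicClosure K) := fun x => AlgEquiv.restrictNormalHom_apply E _ x
  rw [IntermediateField.mem_fixingSubgroup_iff]
  constructor
  · intro h x hx
    change τ • x = x
    rw [← hc ⟨x, hx⟩, h, AlgEquiv.one_apply]
  · intro h
    ext x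
    rw [hc x, AlgEquiv.one_apply]
    exact h x x.2

/-- `τ|_{E₁E₂} = 1 ↔ τ|_{E₁} = 1 ∧ τ|_{E₂} = 1`. [folklore] -/
private theorem absRestrictNormalHom_sup_eq_one_iff' (E₁ E₂ : IntermediateField K (AlgebraicClosure K))
    [Normal K E₁] [Normal K E₂] (τ : absoluteGaloisGroup K) :
    absRestrictNormalHom (E₁ ⊔ E₂ : IntermediateField K (AlgebraicClosure K)) τ = 1 ↔
      absRestrictNormalHom E₁ τ = 1 ∧ absRestrictNormalHom E₂ τ = 1 := by
  rw [absRestrictNormalHom_eq_one_iff_mem_fixingSubgroup',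
    absRestrictNormalHom_eq_one_iff_mem_fixingSubgroup',
    absRestrictNormalHom_eq_one_iff_mem_fixingSubgroup', IntermediateField.fixingSubgroup_sup,
    Subgroup.mem_inf]

/-- The kernel of `Γ_K → Gal(E/K)` is open for `E/K` finite. [folklore] -/
private theorem isOpen_ker_absRestrictNormalHom' (E : IntermediateField K (AlgebraicClosure K))
    [FiniteDimensional K E] [Normal K E] :
    IsOpen ((absRestrictNormalHom E).ker : Set (absoluteGaloisGroup K)) := by
  have h : ((absRestrictNormalHom E).ker : Set (absoluteGaloisGroup K)) =
      (absoluteGaloisGroup.toAlgEquiv K) ⁻¹'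
        (E.fixingSubgroup : Set (AlgebraicClosure K ≃ₐ[K] AlgebraicClosure K)) := by
    ext γ
    rw [SetLike.mem_coe, MonoidHom.mem_ker, absRestrictNormalHom_eq_one_iff_mem_fixingSubgroup',
      Set.mem_preimage, SetLike.mem_coe]
  rw [h]
  exact E.fixingSubgroup_isOpen.preimage continuous_id

variable {p : ℕ} [Fact p.Prime]

/-- `g|_{K_m} = 1 ↔ g ∈ κ⁻¹(pᵐℤ_p)`. [folklore] -/
private theorem absRestrictNormalHom_layer_eq_one_iff' [PerfectField K] (κ : ZpExtension K p)
    (m : ℕ) [Normal K (κ.layer m)] (g : absoluteGaloisGroup K) :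
    absRestrictNormalHom (κ.layer m) g = 1 ↔ g ∈ κ.layerSubgroup m := by
  rw [absRestrictNormalHom_eq_one_iff_mem_fixingSubgroup', κ.fixingSubgroup_layer m]
  constructor
  · rintro ⟨g', hg', hgg'⟩
    have : g' = g := (absoluteGaloisGroup.toAlgEquiv K).injective hgg'
    exact this ▸ hg'
  · exact fun h => ⟨g, h, rfl⟩

/-- Inertia groups of conjugate primes are conjugate: `I_{γ𝔓} = γ I_𝔓 γ⁻¹`. [folklore] -/
private theorem inertia_smul_eq_map_conj' (γ : absoluteGaloisGroup K)
    (𝔓 : Ideal (absIntegers (𝓞 K) K)) :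
    (γ • 𝔓).inertia (absoluteGaloisGroup K) =
      (𝔓.inertia (absoluteGaloisGroup K)).map (MulAut.conj γ).toMonoidHom := by
  ext σ
  rw [Subgroup.mem_map_equiv, Ideal.inertia, Ideal.inertia, AddSubgroup.mem_inertia,
    AddSubgroup.mem_inertia, MulAut.conj_symm_apply]
  constructor
  · intro h x
    have h1 := h (γ • x)
    rw [Submodule.mem_toAddSubgroup, Ideal.mem_pointwise_smul_iff_inv_smul_mem, smul_sub,
      inv_smul_smul, smul_smul, smul_smul] at h1
    exact h1
  · intro h x
    have h1 := h (γ⁻¹ • x)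
    rw [Submodule.mem_toAddSubgroup, Ideal.mem_pointwise_smul_iff_inv_smul_mem, smul_sub,
      smul_smul]
    rwa [smul_smul, mul_inv_cancel_right, Submodule.mem_toAddSubgroup] at h1

/-- `x ∈ I_{γ𝔓} ↔ γ⁻¹xγ ∈ I_𝔓`. [folklore] -/
private theorem mem_inertia_smul_iff (γ : absoluteGaloisGroup K) (𝔓 : Ideal (absIntegers (𝓞 K) K))
    (x : absoluteGaloisGroup K) :
    x ∈ (γ • 𝔓).inertia (absoluteGaloisGroup K) ↔ γ⁻¹ * x * γ ∈ 𝔓.inertia (absoluteGaloisGroup K) := by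
  rw [inertia_smul_eq_map_conj', Subgroup.mem_map_equiv, MulAut.conj_symm_apply]

/-- Conjugates of a prime above `v` lie above `v`. [folklore] -/
private theorem smul_mem_primesAbove' {v : HeightOneSpectrum (𝓞 K)} {𝔓 : Ideal (absIntegers (𝓞 K) K)}
    (h𝔓 : 𝔓 ∈ v.primesAbove) (σ : absoluteGaloisGroup K) : σ • 𝔓 ∈ v.primesAbove := by
  obtain ⟨hprime, hover⟩ := HeightOneSpectrum.mem_primesAbove_iff.mp h𝔓
  haveI := hprime
  refine HeightOneSpectrum.mem_primesAbove_iff.mpr ⟨Ideal.IsPrime.smul _, ⟨?_⟩⟩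
  rw [Ideal.under_smul]
  exact hover.over

variable [NumberField K]

/-- A maximal ideal of `ℤ̄_K` lies above the finite place `𝔓 ∩ 𝓞 K` of `K`. [folklore] -/
private theorem exists_mem_primesAbove_of_isMaximal (𝔓 : Ideal (absIntegers (𝓞 K) K))
    [h𝔓 : 𝔓.IsMaximal] : ∃ v : HeightOneSpectrum (𝓞 K), 𝔓 ∈ v.primesAbove := by
  haveI : (𝔓.under (𝓞 K)).IsMaximal := Ideal.IsMaximal.under (𝓞 K) 𝔓
  have hne : 𝔓.under (𝓞 K) ≠ ⊥ := Ring.ne_bot_of_isMaximal_of_not_isField inferInstance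
    (RingOfIntegers.not_isField K)
  exact ⟨⟨𝔓.under (𝓞 K), Ideal.IsMaximal.isPrime inferInstance, hne⟩,
    HeightOneSpectrum.mem_primesAbove_iff.mpr ⟨h𝔓.isPrime, ⟨rfl⟩⟩⟩

end Helpers

/-! ## §1 The general criterion: `Hom_{Γ_K}(Cl(L₀K_n), M) = 0 ∀ n ⟹ Sel₀(K_∞, M)` finite -/

section General

variable {K : Type} [Field K] [NumberField K] {p : ℕ} [Fact p.Prime]

set_option maxHeartbeats 1600000 in
set_option synthInstance.maxHeartbeats 200000 in
/-- **`Hom_{Γ_K}(Cl(L₀K_{n+1}), M) = 0` for all `n` ⟹ `Sel₀(K_∞, M)` is finite** — the form of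
`finite_fineSelmerInfty_of_forall_equivariantHom_classGroup_eq_zero` (next) with its hypothesis required
only at the layers `n + 1 ≥ 1` (the descent of the proof always lands at such a layer, «one layer up»);
this is the form fed by the `S`-version of door L6 (`EquivariantIwasawaLemma…_of_splitAt`, whose output
starts at layer `1`).  Hypotheses and proof: see the next theorem and the module docstring.
[cite: CoatesSujatha2005, §3 Thm. 3.4 (proof) and Lemma 3.8]
[cite: Washington1997, §13.1 Lemma 13.3, §13.3 Lemmas 13.14–13.15 and Thm. 10.4 (proof)] -/
theorem finite_fineSelmerInfty_of_forall_equivariantHom_classGroup_eq_zero_succ (hp2 : p ≠ 2)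
    (κ : ZpExtension K p) (L₀ : IntermediateField K (AlgebraicClosure K)) [FiniteDimensional K L₀]
    [IsGalois K L₀] [∀ n, FiniteDimensional K (κ.layer n)] [∀ n, IsGalois K (κ.layer n)]
    {M : Type} [AddCommGroup M] [DistribMulAction (absoluteGaloisGroup K) M] [TopologicalSpace M]
    [DiscreteTopology M] [Finite M] (hpM : ∀ m : M, p • m = 0)
    (htriv : ∀ σ : absoluteGaloisGroup K, absRestrictNormalHom L₀ σ = 1 → ∀ m : M, σ • m = m)
    (v₀ : HeightOneSpectrum (𝓞 K)) (hv₀ : ((p : ℕ) : 𝓞 K) ∈ v₀.asIdeal)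
    (huniq : ∀ v : HeightOneSpectrum (𝓞 K), ((p : ℕ) : 𝓞 K) ∈ v.asIdeal → v = v₀)
    {𝔓₀ : Ideal (absIntegers (𝓞 K) K)} (h𝔓₀ : 𝔓₀ ∈ v₀.primesAbove)
    (hram : 𝔓₀.inertia (absoluteGaloisGroup K) ⊔ κ.kerSubgroup = ⊤)
    (hL6 : ∀ (n : ℕ)
      (f : Additive (ClassGroup (𝓞 (L₀ ⊔ κ.layer (n + 1) : IntermediateField K (AlgebraicClosure K))))
        →+ M),
      (∀ (τ : absoluteGaloisGroup K)
          (c : ClassGroup (𝓞 (L₀ ⊔ κ.layer (n + 1) : IntermediateField K (AlgebraicClosure K)))),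
        f (Additive.ofMul (ClassGroup.mulEquiv (AmbiguousClass.intAut
          (absRestrictNormalHom (L₀ ⊔ κ.layer (n + 1) : IntermediateField K (AlgebraicClosure K)) τ))
            c)) = τ • f (Additive.ofMul c)) →
      f = 0) :
    (fineSelmerInfty M κ : Set (subgroupH1 κ.kerSubgroup M)).Finite := by
  classical
  by_contra hinf
  change (fineSelmerInfty M κ : Set (subgroupH1 κ.kerSubgroup M)).Infinite at hinf
  have hp : p.Prime := Fact.out
  haveI := absoluteGaloisGroup_compactSpace K
  -- ### `Λ₀ = Γ_{L₀}`
  set Λ₀ : Subgroup (absoluteGaloisGroup K) := (absRestrictNormalHom L₀).ker with hΛ₀def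
  have hmemΛ₀ : ∀ σ, σ ∈ Λ₀ ↔ absRestrictNormalHom L₀ σ = 1 := fun σ => MonoidHom.mem_ker
  haveI hΛ₀n : Λ₀.Normal := by rw [hΛ₀def]; infer_instance
  have hΛ₀open : IsOpen (Λ₀ : Set (absoluteGaloisGroup K)) := by
    rw [hΛ₀def]; exact isOpen_ker_absRestrictNormalHom' L₀
  haveI : Λ₀.FiniteIndex := by
    haveI := Subgroup.quotient_finite_of_isOpen Λ₀ hΛ₀open
    exact Subgroup.finiteIndex_of_finite_quotient
  have htrivΛ₀ : ∀ σ ∈ Λ₀, ∀ m : M, σ • m = m := fun σ hσ => htriv σ ((hmemΛ₀ σ).1 hσ)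
  -- ### (1) the invariant non-zero shadow
  obtain ⟨f, z, hzS, hfz, hf, hne, hinv⟩ :=
    FineSelmerResidualCharacter.exists_invariant_shadow κ Λ₀ hΛ₀open hpM htrivΛ₀ hinf
  -- ### data for the descent
  set κ' : absoluteGaloisGroup K →* Multiplicative ℤ_[p] := κ.toContinuousMonoidHom.toMonoidHom
    with hκ'def
  have hκ' : ∀ σ, κ' σ = κ σ := fun _ => rfl
  set H' : Subgroup (absoluteGaloisGroup K) := Λ₀ ⊓ κ.kerSubgroup with hH'def
  have hH' : ∀ σ, σ ∈ H' ↔ σ ∈ Λ₀ ∧ κ' σ = 1 := fun σ => by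
    rw [hH'def, Subgroup.mem_inf, ZpExtension.mem_kerSubgroup, hκ']
  let Λ : ℕ → Subgroup (absoluteGaloisGroup K) := fun m => Λ₀ ⊓ κ.layerSubgroup m
  have hΛinf : ∀ m, Λ m = Λ₀ ⊓ κ.layerSubgroup m := fun _ => rfl
  have hΛ : ∀ m σ, σ ∈ Λ m ↔ σ ∈ Λ₀ ∧ (p : ℤ_[p]) ^ m ∣ (κ' σ).toAdd := fun m σ => by
    rw [hΛinf, Subgroup.mem_inf, ZpExtension.mem_layerSubgroup, hκ']
  -- primes of `ℤ̄_K` together with the place below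
  let ι := {x : HeightOneSpectrum (𝓞 K) × Ideal (absIntegers (𝓞 K) K) // x.2 ∈ x.1.primesAbove}
  let I : ι → Subgroup (absoluteGaloisGroup K) := fun i => i.1.2.inertia (absoluteGaloisGroup K)
  have hIdef : ∀ i, I i = i.1.2.inertia (absoluteGaloisGroup K) := fun _ => rfl
  let pAdic : ι → Prop := fun i => ((p : ℕ) : 𝓞 K) ∈ i.1.1.asIdeal
  have hpAdic : ∀ i, pAdic i ↔ ((p : ℕ) : 𝓞 K) ∈ i.1.1.asIdeal := fun _ => Iff.rfl
  let i₀ : ι := ⟨(v₀, 𝔓₀), h𝔓₀⟩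
  have hi₀ : pAdic i₀ := hv₀
  have hconj : ∀ g : absoluteGaloisGroup K, ∃ j, pAdic j ∧ ∀ x, x ∈ I j ↔ g⁻¹ * x * g ∈ I i₀ :=
    fun g => ⟨⟨(v₀, g • 𝔓₀), smul_mem_primesAbove' h𝔓₀ g⟩, hv₀, fun x => mem_inertia_smul_iff g 𝔓₀ x⟩
  have hIker : ∀ i, ¬ pAdic i → ∀ x ∈ I i, κ' x = 1 := by
    intro i hi x hx
    exact ZpExtension.mem_kerSubgroup.1 (ZpExtension.inertia_le_kerSubgroup_holds K p κ hi i.2 hx)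
  have htrans : ∀ i, pAdic i → ∃ g : absoluteGaloisGroup K, ∀ x, x ∈ I i ↔ g⁻¹ * x * g ∈ I i₀ := by
    intro i hi
    have hv : i.1.1 = v₀ := huniq _ hi
    have h𝔓 : i.1.2 ∈ v₀.primesAbove := hv ▸ i.2
    obtain ⟨γ, hγ⟩ := HeightOneSpectrum.exists_smul_eq_of_mem_primesAbove_holds h𝔓₀ h𝔓
    refine ⟨γ, fun x => ?_⟩
    rw [hIdef, hIdef, ← hγ]
    exact mem_inertia_smul_iff γ 𝔓₀ x
  have hsurj : ∀ t : ℤ_[p], ∃ y ∈ I i₀, (κ' y).toAdd = t := by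
    intro t
    obtain ⟨γ, hγ⟩ := κ.surjective (Multiplicative.ofAdd t)
    rw [ZpExtension.coe_toContinuousMonoidHom] at hγ
    haveI : κ.kerSubgroup.Normal := by
      change (κ.toContinuousMonoidHom.toMonoidHom.ker).Normal
      infer_instance
    have hγmem : γ ∈ ((𝔓₀.inertia (absoluteGaloisGroup K) ⊔ κ.kerSubgroup :
        Subgroup (absoluteGaloisGroup K)) : Set (absoluteGaloisGroup K)) := by
      rw [hram]; trivial
    rw [Subgroup.mul_normal] at hγmem
    obtain ⟨i, hi, n, hn, rfl⟩ := Set.mem_mul.mp hγmem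
    refine ⟨i, hi, ?_⟩
    have hn1 : κ n = 1 := ZpExtension.mem_kerSubgroup.mp hn
    rw [map_mul, hn1, mul_one] at hγ
    rw [hκ', hγ]
    rfl
  obtain ⟨e, he⟩ :=
    EquivariantUnramifiedDescent.exists_level_totallyRamified κ' Λ₀ I pAdic i₀ htrans hsurj
  -- ### the hypotheses on the shadow `φ = f`
  have hφ_mul : ∀ a ∈ H', ∀ b ∈ H', f (a * b) = f a + f b := fun a ha b hb =>
    FineSelmerResidualCharacter.shadow_mul κ Λ₀ htrivΛ₀ f z hfz ha hb
  have hφ_equiv : ∀ (g : absoluteGaloisGroup K), ∀ τ ∈ H', f (g * τ * g⁻¹) = g • f τ := by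
    intro g τ _
    have h : g • f (g⁻¹ * (g * τ * g⁻¹) * g) = f (g * τ * g⁻¹) := congr_fun (hinv g) (g * τ * g⁻¹)
    rw [← h]
    have e1 : g⁻¹ * (g * τ * g⁻¹) * g = τ := by group
    rw [e1]
  have hφ_I : ∀ i, ∀ τ ∈ I i, τ ∈ H' → f τ = 0 := by
    rintro ⟨⟨v, 𝔓⟩, h𝔓⟩ τ hτ hτH
    obtain ⟨γ, hγ⟩ := HeightOneSpectrum.exists_smul_eq_of_mem_primesAbove_holds h𝔓
      (adicCompletionPrime_mem_primesAbove K v)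
    refine FineSelmerResidualCharacter.shadow_eq_zero_of_conj_mem_decomp κ Λ₀ htrivΛ₀ f z hzS hfz v
      γ⁻¹ (by rw [hH'def] at hτH; exact hτH) ?_
    rw [inv_inv]
    have h1 : γ * τ * γ⁻¹ ∈ (adicCompletionPrime K v).inertia (absoluteGaloisGroup K) := by
      rw [← hγ, mem_inertia_smul_iff]
      have e1 : γ⁻¹ * (γ * τ * γ⁻¹) * γ = τ := by group
      rw [e1]
      exact hτ
    have h2 := (Ideal.inertia_le_decompositionSubgroup (absoluteGaloisGroup K)
      (adicCompletionPrime K v)) h1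
    rw [decompositionSubgroup_adicCompletionPrime_eq_range K v] at h2
    exact h2
  -- ### (2) the equivariant unramified descent at level `e + 1`
  obtain ⟨Q, ψ, hQmem, hQle, hQconj, hψφ, hψmul, hψeq, hψI, hψker, -⟩ :=
    EquivariantUnramifiedDescent.exists_equivariant_unramified_extension κ' Λ₀ H' hH' Λ hΛ hpM
      htrivΛ₀ I pAdic i₀ hi₀ hconj hIker e (he e le_rfl) f hφ_mul hφ_equiv hφ_I
  haveI hQn : Q.Normal := ⟨fun x hx g => hQconj g x hx⟩
  have hΛopen : IsOpen (Λ (e + 1) : Set (absoluteGaloisGroup K)) := by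
    rw [hΛinf, Subgroup.coe_inf]
    exact hΛ₀open.inter (κ.isOpen_layerSubgroup (e + 1))
  haveI : (Λ (e + 1)).FiniteIndex := by
    haveI := Subgroup.quotient_finite_of_isOpen (Λ (e + 1)) hΛopen
    exact Subgroup.finiteIndex_of_finite_quotient
  -- `Q` is open
  have hQopen : IsOpen (Q : Set (absoluteGaloisGroup K)) := by
    refine EquivariantUnramifiedDescent.isOpen_of_eq_mul_of_ker Q (Λ (e + 1)) hQle
      ((I i₀ : Set (absoluteGaloisGroup K)) ∩ (Λ (e + 1) : Set (absoluteGaloisGroup K)))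
      {k | k ∈ H' ∧ f k = 0} ?_ ?_ ?_ ψ hψmul hψker
    · refine IsClosed.isCompact (IsClosed.inter ?_ (Subgroup.isClosed_of_isOpen _ hΛopen))
      exact absIntegers.isClosed_inertia_holds (R := 𝓞 K) (K := K) 𝔓₀
    · have hcl : IsClosed {τ : κ.kerSubgroup | (τ : absoluteGaloisGroup K) ∈ Λ₀ ∧ z.1 τ = 0} := by
        refine IsClosed.inter ?_ ?_
        · exact (Subgroup.isClosed_of_isOpen _ hΛ₀open).preimage continuous_subtype_val
        · exact (isClosed_discrete {(0 : M)}).preimage z.1.continuous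
      have himg : {k : absoluteGaloisGroup K | k ∈ H' ∧ f k = 0} =
          Subtype.val '' {τ : κ.kerSubgroup | (τ : absoluteGaloisGroup K) ∈ Λ₀ ∧ z.1 τ = 0} := by
        ext k
        constructor
        · rintro ⟨hkH, hk0⟩
          rw [hH'def] at hkH
          obtain ⟨hkΛ, hkker⟩ := Subgroup.mem_inf.1 hkH
          refine ⟨⟨k, hkker⟩, ⟨hkΛ, ?_⟩, rfl⟩
          rw [← hfz ⟨k, hkker⟩ hkΛ]
          exact hk0
        · rintro ⟨τ, ⟨hτΛ, hτ0⟩, rfl⟩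
          refine ⟨?_, ?_⟩
          · rw [hH'def]; exact Subgroup.mem_inf.2 ⟨hτΛ, τ.2⟩
          · rw [hfz τ hτΛ]
            exact hτ0
      rw [himg]
      exact κ.isClosed_kerSubgroup.isClosedEmbedding_subtypeVal.isClosedMap _ hcl
    · ext x
      rw [SetLike.mem_coe, hQmem, Set.mem_mul]
      constructor
      · rintro ⟨y, hyI, k, hkH, hyΛ, hk0, rfl⟩
        exact ⟨y, ⟨hyI, hyΛ⟩, k, ⟨hkH, hk0⟩, rfl⟩
      · rintro ⟨y, ⟨hyI, hyΛ⟩, k, ⟨hkH, hk0⟩, rfl⟩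
        exact ⟨y, hyI, k, hkH, hyΛ, hk0, rfl⟩
  -- ### (3) class field theory at the layer `L₀K_{e+1}`
  have hΛ' : ∀ σ, σ ∈ Λ (e + 1) ↔
      absRestrictNormalHom (L₀ ⊔ κ.layer (e + 1) : IntermediateField K (AlgebraicClosure K)) σ = 1 := by
    intro σ
    rw [hΛinf, Subgroup.mem_inf, absRestrictNormalHom_sup_eq_one_iff',
      absRestrictNormalHom_layer_eq_one_iff', hmemΛ₀]
  have hψI' : ∀ (𝔓 : Ideal (absIntegers (𝓞 K) K)), 𝔓.IsMaximal →
      ∀ σ ∈ 𝔓.inertia (absoluteGaloisGroup K), σ ∈ Λ (e + 1) → ψ σ = 0 := by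
    intro 𝔓 h𝔓 σ hσ hσΛ
    haveI := h𝔓
    obtain ⟨v, hv⟩ := exists_mem_primesAbove_of_isMaximal 𝔓
    exact hψI ⟨(v, 𝔓), hv⟩ σ hσ hσΛ
  have hzero :=
    EquivariantUnramifiedDescent.forall_eq_zero_of_forall_equivariantHom_classGroup_eq_zero p hp2
      (L₀ ⊔ κ.layer (e + 1) : IntermediateField K (AlgebraicClosure K)) (Λ (e + 1)) Q hΛ' hQopen
      hQle hpM ψ hψmul hψeq hψker hψI' (hL6 e)
  -- ### contradiction: `f ≠ 0` but `ψ|_{H′} = f|_{H′}` vanishes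
  apply hne
  funext τ
  rw [Pi.zero_apply]
  by_cases hτ : τ ∈ H'
  · have hτΛ : τ ∈ Λ (e + 1) := by
      rw [hΛ]
      refine ⟨((hH' τ).1 hτ).1, ?_⟩
      rw [((hH' τ).1 hτ).2, toAdd_one]
      exact dvd_zero _
    rw [← hψφ τ hτ]
    exact hzero τ hτΛ
  · rw [hH'def] at hτ
    exact hf τ hτ

set_option maxHeartbeats 1600000 in
set_option synthInstance.maxHeartbeats 200000 in
/-- **`Hom_{Γ_K}(Cl(L₀K_n), M) = 0` for all `n` ⟹ `Sel₀(K_∞, M)` is finite** (Coates–Sujatha 2005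
Thm. 3.4, isotypic form, `H²`-free proof).  `K` a number field, `p` an odd prime, `κ` a
`ℤ_p`-extension of `K` with layers `K_n = κ.layer n` (finite Galois over `K`), `L₀ ⊆ K̄` finite Galois
over `K`; `M` a finite discrete `Γ_K`-module with `pM = 0` on which `Γ_{L₀} = {σ : σ|_{L₀} = 1}` acts
trivially; `v₀` the ONLY finite place of `K` containing `p`, and a prime `𝔓₀ ∣ v₀` of `ℤ̄_K` totally
ramified in `K_∞/K` (`I_{𝔓₀} · Gal(K̄/K_∞) = Γ_K`).  If for every `n` every additive `Γ_K`-equivariant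
`Cl(𝓞_{L₀K_n}) → M` is zero (equivariance through `τ ↦ ClassGroup.mulEquiv (intAut τ|_{L₀K_n})`), then
the fine Selmer group `Sel₀(K_∞, M)` (`GreenbergSelmer.fineSelmerInfty M κ`) is finite.  See the module
docstring for the proof (invariant shadow ⟹ equivariant unramified descent ⟹ equivariant Artin
reciprocity). [cite: CoatesSujatha2005, §3 Thm. 3.4 (proof) and Lemma 3.8]
[cite: Washington1997, §13.1 Lemma 13.3, §13.3 Lemmas 13.14–13.15 and Thm. 10.4 (proof)] -/
theorem finite_fineSelmerInfty_of_forall_equivariantHom_classGroup_eq_zero (hp2 : p ≠ 2)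
    (κ : ZpExtension K p) (L₀ : IntermediateField K (AlgebraicClosure K)) [FiniteDimensional K L₀]
    [IsGalois K L₀] [∀ n, FiniteDimensional K (κ.layer n)] [∀ n, IsGalois K (κ.layer n)]
    {M : Type} [AddCommGroup M] [DistribMulAction (absoluteGaloisGroup K) M] [TopologicalSpace M]
    [DiscreteTopology M] [Finite M] (hpM : ∀ m : M, p • m = 0)
    (htriv : ∀ σ : absoluteGaloisGroup K, absRestrictNormalHom L₀ σ = 1 → ∀ m : M, σ • m = m)
    (v₀ : HeightOneSpectrum (𝓞 K)) (hv₀ : ((p : ℕ) : 𝓞 K) ∈ v₀.asIdeal)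
    (huniq : ∀ v : HeightOneSpectrum (𝓞 K), ((p : ℕ) : 𝓞 K) ∈ v.asIdeal → v = v₀)
    {𝔓₀ : Ideal (absIntegers (𝓞 K) K)} (h𝔓₀ : 𝔓₀ ∈ v₀.primesAbove)
    (hram : 𝔓₀.inertia (absoluteGaloisGroup K) ⊔ κ.kerSubgroup = ⊤)
    (hL6 : ∀ (n : ℕ)
      (f : Additive (ClassGroup (𝓞 (L₀ ⊔ κ.layer n : IntermediateField K (AlgebraicClosure K)))) →+ M),
      (∀ (τ : absoluteGaloisGroup K)
          (c : ClassGroup (𝓞 (L₀ ⊔ κ.layer n : IntermediateField K (AlgebraicClosure K)))),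
        f (Additive.ofMul (ClassGroup.mulEquiv (AmbiguousClass.intAut
          (absRestrictNormalHom (L₀ ⊔ κ.layer n : IntermediateField K (AlgebraicClosure K)) τ)) c)) =
          τ • f (Additive.ofMul c)) →
      f = 0) :
    (fineSelmerInfty M κ : Set (subgroupH1 κ.kerSubgroup M)).Finite :=
  finite_fineSelmerInfty_of_forall_equivariantHom_classGroup_eq_zero_succ hp2 κ L₀ hpM htriv v₀ hv₀ huniq
    h𝔓₀ hram fun n => hL6 (n + 1)

end General

/-! ## §2 Elliptic curves over `ℚ`: door L6 ⟹ Conjecture A -/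

section Rat

variable {p : ℕ} [Fact p.Prime]

omit [Fact p.Prime] in
/-- The only place of `ℚ` containing the prime `p`. [folklore] -/
private theorem heightOneSpectrum_rat_eq_of_natCast_mem (hp : p.Prime) (v v' : HeightOneSpectrum (𝓞 ℚ))
    (hv : ((p : ℕ) : 𝓞 ℚ) ∈ v.asIdeal) (hv' : ((p : ℕ) : 𝓞 ℚ) ∈ v'.asIdeal) : v = v' := by
  have key : ∀ w : HeightOneSpectrum (𝓞 ℚ), ((p : ℕ) : 𝓞 ℚ) ∈ w.asIdeal →
      Rat.HeightOneSpectrum.primesEquiv w = ⟨p, hp⟩ := by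
    intro w hw
    apply Subtype.ext
    change Rat.HeightOneSpectrum.natGenerator w = p
    have h1 : Rat.HeightOneSpectrum.natGenerator w ∣ p := by
      rw [Rat.HeightOneSpectrum.natGenerator_dvd_iff,
        ← map_natCast (Rat.IsIntegralClosure.intEquiv (𝓞 ℚ)) p]
      exact Ideal.mem_map_of_mem _ hw
    exact (Nat.prime_dvd_prime_iff_eq (Rat.HeightOneSpectrum.prime_natGenerator w) hp).mp h1
  exact Rat.HeightOneSpectrum.primesEquiv.injective ((key v hv).trans (key v' hv').symm)

omit [Fact p.Prime] in
/-- `E[p]` is killed by `p`. [folklore] -/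
private theorem geomTorsion_nsmul_eq_zero (W : WeierstrassCurve ℚ) [W.IsElliptic]
    (v : geomTorsion W (p : ℤ)) : p • v = 0 := by
  apply Subtype.ext
  have hv : ((v : geomTorsion W (p : ℤ)) : geomPoints W) ∈
      AddSubgroup.torsionBy (geomPoints W) (p : ℤ) := v.2
  rw [AddSubgroup.torsionBy, Submodule.mem_toAddSubgroup, Submodule.mem_torsionBy_iff] at hv
  rw [AddSubgroupClass.coe_nsmul, ZeroMemClass.coe_zero, ← natCast_zsmul]
  exact hv

set_option maxHeartbeats 800000 in
set_option synthInstance.maxHeartbeats 200000 in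
/-- **Door L6 output at the layers `n + 1` ⟹ `Sel₀(ℚ_∞, E[p])` finite** — as
`finite_fineSelmerInfty_torsion_of_homTrivial_cyclotomicTower` (next), with the vanishing of the
equivariant `Cl(𝓞_{ℚ(E[p])ℚ_{n+1}}) → E[p]` required only for the layers `≥ 1` (the output of the
`S`-version of door L6). [cite: CoatesSujatha2005, §3 Thm. 3.4 (proof) and Lemma 3.8]
[cite: Washington1997, §13.1, §13.3] -/
theorem finite_fineSelmerInfty_torsion_of_homTrivial_cyclotomicTower_succ
    (W : WeierstrassCurve ℚ) [W.IsElliptic] (hp2 : p ≠ 2) {κ : ZpExtension ℚ p} (hκ : κ.IsCyclotomic)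
    (hL6 : ∀ n : ℕ, haveI := κ.isGalois_layer_holds (n + 1)
      ∀ (f : Additive (ClassGroup (𝓞 ↥(W.divisionField p ⊔ κ.layer (n + 1)))) →+
        geomTorsion W (p : ℤ)),
      (∀ (τ : absoluteGaloisGroup ℚ) (c : ClassGroup (𝓞 ↥(W.divisionField p ⊔ κ.layer (n + 1)))),
        f (Additive.ofMul (ClassGroup.mulEquiv (AmbiguousClass.intAut
          (absRestrictNormalHom (W.divisionField p ⊔ κ.layer (n + 1)) τ)) c)) =
          τ • f (Additive.ofMul c)) →
      f = 0) :
    (fineSelmerInfty (↥(W.geomTorsion (p : ℤ))) κ :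
      Set (subgroupH1 κ.kerSubgroup (W.geomTorsion (p : ℤ)))).Finite := by
  have hp : p.Prime := Fact.out
  haveI hgal := fun m => κ.isGalois_layer_holds m
  haveI hfd := fun m => κ.finiteDimensional_layer_holds m
  haveI : Finite (geomTorsion W (p : ℤ)) :=
    finite_torsionPoints_holds W (AlgebraicClosure ℚ) (by exact_mod_cast hp.ne_zero)
  -- the totally ramified prime and the place of `p`
  obtain ⟨𝔓', h𝔓'max, hsup⟩ :=
    EquivariantIwasawaLemma.exists_isMaximal_inertia_sup_kerSubgroup_eq_top_of_isCyclotomic hκ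
  haveI := h𝔓'max
  obtain ⟨v₀, hv₀𝔓⟩ := exists_mem_primesAbove_of_isMaximal (K := ℚ) 𝔓'
  have hv₀ : ((p : ℕ) : 𝓞 ℚ) ∈ v₀.asIdeal := by
    by_contra h
    have hle := ZpExtension.inertia_le_kerSubgroup_holds ℚ p κ h hv₀𝔓
    have htop : κ.kerSubgroup = ⊤ := by
      rw [eq_top_iff, ← hsup]
      exact sup_le hle le_rfl
    obtain ⟨γ, hγ⟩ := κ.surjective (Multiplicative.ofAdd 1)
    rw [ZpExtension.coe_toContinuousMonoidHom] at hγ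
    have h1 : κ γ = 1 := ZpExtension.mem_kerSubgroup.mp (htop ▸ Subgroup.mem_top γ)
    rw [hγ] at h1
    have h2 : (1 : ℤ_[p]) = 0 := Multiplicative.ofAdd.injective h1
    exact one_ne_zero h2
  exact finite_fineSelmerInfty_of_forall_equivariantHom_classGroup_eq_zero_succ hp2 κ (W.divisionField p)
    (geomTorsion_nsmul_eq_zero W)
    (fun τ hτ v => (W.absRestrictNormalHom_divisionField_eq_one_iff p τ).mp hτ v) v₀ hv₀
    (fun v hv => heightOneSpectrum_rat_eq_of_natCast_mem hp v v₀ hv hv₀) hv₀𝔓 hsup hL6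

set_option maxHeartbeats 800000 in
set_option synthInstance.maxHeartbeats 200000 in
/-- **Door L6 output ⟹ `Sel₀(ℚ_∞, E[p])` finite.**  `E/ℚ` (`W`), `p` odd, `κ` the cyclotomic
`ℤ_p`-extension, `L_n = ℚ(E[p])ℚ_n = W.divisionField p ⊔ κ.layer n`.  If for every `n` every additive
`Γ_ℚ`-equivariant `Cl(𝓞_{L_n}) → E[p]` is zero — the conclusion of
`DeoRaySujatha2023.homTrivial_divisionField_cyclotomicTower` — then the fine Selmer group of `E[p]`
over `ℚ_∞` is finite.  (`finite_fineSelmerInfty_of_forall_equivariantHom_classGroup_eq_zero` at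
`K = ℚ`: `p` lies in one place of `ℚ`, totally ramified in `ℚ_∞`, tree
`exists_isMaximal_inertia_sup_kerSubgroup_eq_top_of_isCyclotomic`.)
[cite: CoatesSujatha2005, §3 Thm. 3.4 (proof) and Lemma 3.8] [cite: Washington1997, §13.1, §13.3] -/
theorem finite_fineSelmerInfty_torsion_of_homTrivial_cyclotomicTower
    (W : WeierstrassCurve ℚ) [W.IsElliptic] (hp2 : p ≠ 2) {κ : ZpExtension ℚ p} (hκ : κ.IsCyclotomic)
    (hL6 : ∀ n : ℕ, haveI := κ.isGalois_layer_holds n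
      ∀ (f : Additive (ClassGroup (𝓞 ↥(W.divisionField p ⊔ κ.layer n))) →+ geomTorsion W (p : ℤ)),
      (∀ (τ : absoluteGaloisGroup ℚ) (c : ClassGroup (𝓞 ↥(W.divisionField p ⊔ κ.layer n))),
        f (Additive.ofMul (ClassGroup.mulEquiv (AmbiguousClass.intAut
          (absRestrictNormalHom (W.divisionField p ⊔ κ.layer n) τ)) c)) = τ • f (Additive.ofMul c)) →
      f = 0) :
    (fineSelmerInfty (↥(W.geomTorsion (p : ℤ))) κ :
      Set (subgroupH1 κ.kerSubgroup (W.geomTorsion (p : ℤ)))).Finite :=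
  finite_fineSelmerInfty_torsion_of_homTrivial_cyclotomicTower_succ W hp2 hκ fun n => hL6 (n + 1)

/-- **Door L6 output at the layers `n + 1` ⟹ statement (A)** for `E` at the odd prime `p` over
`ℚ_cyc` — as `conjA_of_homTrivial_cyclotomicTower` (next), with the hypothesis only at the layers `≥ 1`;
the entry point for the `S`-version of door L6 (Deo–Ray–Sujatha's (c2) as printed).
[cite: CoatesSujatha2005, §3 Thm. 3.4 and Lemma 3.8]
[cite: LimSujatha2018, §3 (the lemma before Prop. 3.2)] -/
theorem conjA_of_homTrivial_cyclotomicTower_succ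
    (W : WeierstrassCurve ℚ) [W.IsElliptic] (hp2 : p ≠ 2) {κ : ZpExtension ℚ p} (hκ : κ.IsCyclotomic)
    (hL6 : ∀ n : ℕ, haveI := κ.isGalois_layer_holds (n + 1)
      ∀ (f : Additive (ClassGroup (𝓞 ↥(W.divisionField p ⊔ κ.layer (n + 1)))) →+
        geomTorsion W (p : ℤ)),
      (∀ (τ : absoluteGaloisGroup ℚ) (c : ClassGroup (𝓞 ↥(W.divisionField p ⊔ κ.layer (n + 1)))),
        f (Additive.ofMul (ClassGroup.mulEquiv (AmbiguousClass.intAut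
          (absRestrictNormalHom (W.divisionField p ⊔ κ.layer (n + 1)) τ)) c)) =
          τ • f (Additive.ofMul c)) →
      f = 0) :
    ∃ (γ : absoluteGaloisGroup ℚ) (D : W.FineSelmerDualData κ γ),
      Module.Finite ℤ_[p] (RestrictScalars ℤ_[p] (IwasawaAlgebra p) D.X) :=
  (LimSujatha2018.fineSelmerDual_moduleFinite_iff_finite_fineSelmerInfty_torsion W hp2 κ hκ).mpr
    (finite_fineSelmerInfty_torsion_of_homTrivial_cyclotomicTower_succ W hp2 hκ hL6)

/-- **Door L6 output ⟹ statement (A)** for `E` at the odd prime `p` over `ℚ_cyc`: the Pontryagin dual of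
`Sel₀(ℚ_∞, E[p^∞])` is finitely generated over `ℤ_p` (tree form `∃ γ D, Module.Finite ℤ_[p] D.X`), by
`finite_fineSelmerInfty_torsion_of_homTrivial_cyclotomicTower` and Lim–Sujatha's lemma
`LimSujatha2018.fineSelmerDual_moduleFinite_iff_finite_fineSelmerInfty_torsion`.
[cite: CoatesSujatha2005, §3 Thm. 3.4 and Lemma 3.8]
[cite: LimSujatha2018, §3 (the lemma before Prop. 3.2)] -/
theorem conjA_of_homTrivial_cyclotomicTower
    (W : WeierstrassCurve ℚ) [W.IsElliptic] (hp2 : p ≠ 2) {κ : ZpExtension ℚ p} (hκ : κ.IsCyclotomic)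
    (hL6 : ∀ n : ℕ, haveI := κ.isGalois_layer_holds n
      ∀ (f : Additive (ClassGroup (𝓞 ↥(W.divisionField p ⊔ κ.layer n))) →+ geomTorsion W (p : ℤ)),
      (∀ (τ : absoluteGaloisGroup ℚ) (c : ClassGroup (𝓞 ↥(W.divisionField p ⊔ κ.layer n))),
        f (Additive.ofMul (ClassGroup.mulEquiv (AmbiguousClass.intAut
          (absRestrictNormalHom (W.divisionField p ⊔ κ.layer n) τ)) c)) = τ • f (Additive.ofMul c)) →
      f = 0) :
    ∃ (γ : absoluteGaloisGroup ℚ) (D : W.FineSelmerDualData κ γ),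
      Module.Finite ℤ_[p] (RestrictScalars ℤ_[p] (IwasawaAlgebra p) D.X) :=
  conjA_of_homTrivial_cyclotomicTower_succ W hp2 hκ fun n => hL6 (n + 1)

/-- **DOOR L6 ⟹ CONJECTURE A (the cell's census road, kernel form).**  `E/ℚ` elliptic (`W`), `p` an
odd prime, `κ` the cyclotomic `ℤ_p`-extension of `ℚ`.  Assume (c1) `p ∤ #Gal(ℚ(E[p])/ℚ)`; (c2*)₀ every
additive `Γ_ℚ`-equivariant `Cl(𝓞_{ℚ(E[p])}) → E[p]` is zero (⟸ `p ∤ h(ℚ(E[p]))`, tree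
`homTrivial_divisionField_cyclotomicTower_of_not_dvd_classNumber`); (c3*) at the place `v ∋ p`, no
non-zero point of `E[p]` is fixed by the decomposition group `D_v` (⟸ `E(ℚ_p)[p] = 0`).  Then statement
(A) holds for `E` at `p`: the dual fine Selmer group over `ℚ_∞` is finitely generated over `ℤ_p`.
Proof: door L6 (`DeoRaySujatha2023.homTrivial_divisionField_cyclotomicTower`: the `E[p]`-part of
`Cl(ℚ_n(E[p]))` is absent for all `n`) and `conjA_of_homTrivial_cyclotomicTower`.
[cite: CoatesSujatha2005, §3 Thm. 3.4, Lemma 3.8 and Cor. 3.6]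
[cite: Washington1997, §13.1 Prop. 13.2, §13.3 Lemmas 13.14–13.15 and Thm. 10.4 (proof)]
[cite: DeoRaySujatha2023, §3 Thm. 3.8 hypotheses (c1)–(c3) (arXiv:2202.09937 p. 9)] -/
theorem conjA_of_homTrivial_divisionField
    (W : WeierstrassCurve ℚ) [W.IsElliptic] [NeZero p] (hp2 : p ≠ 2)
    [NumberField (W.divisionField p)]
    (hG : ¬ p ∣ Nat.card ((W.divisionField p) ≃ₐ[ℚ] (W.divisionField p)))
    {κ : ZpExtension ℚ p} (hκ : κ.IsCyclotomic)
    (h0 : ∀ μ : Additive (ClassGroup (𝓞 (W.divisionField p))) →+ geomTorsion W (p : ℤ),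
      (∀ (τ : absoluteGaloisGroup ℚ) (c : ClassGroup (𝓞 (W.divisionField p))),
        μ (Additive.ofMul (ClassGroup.mulEquiv
          (AmbiguousClass.intAut (absRestrictNormalHom (W.divisionField p) τ)) c)) =
          τ • μ (Additive.ofMul c)) → μ = 0)
    (hD : ∀ v : HeightOneSpectrum (𝓞 ℚ), ((p : ℕ) : 𝓞 ℚ) ∈ v.asIdeal →
      ∀ x : geomTorsion W (p : ℤ), (∀ d ∈ GreenbergSelmer.decomp v, d • x = x) → x = 0) :
    ∃ (γ : absoluteGaloisGroup ℚ) (D : W.FineSelmerDualData κ γ),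
      Module.Finite ℤ_[p] (RestrictScalars ℤ_[p] (IwasawaAlgebra p) D.X) :=
  conjA_of_homTrivial_cyclotomicTower W hp2 hκ
    (DeoRaySujatha2023.homTrivial_divisionField_cyclotomicTower W p hp2 hG hκ h0 hD)

end Rat

/-! ## §3 APPEND (same seat, g17): the two per-row entry points of the census

The numerical certificates of the cell's L6 census feed (c2*)₀ either from the class number of `ℚ(E[p])`
(«`p ∤ h(ℚ(E[p]))`», tree `DeoRaySujatha2023.homTrivial_divisionField_cyclotomicTower_of_not_dvd_classNumber`)
or from the tautological eigen-test on `Cl(ℚ(P))` (tree `…_of_eigenHom_subfield'`); both with (c3) in the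
`E[p^∞]`-currency of the Deo–Ray–Sujatha facts.  Composed with `conjA_of_homTrivial_cyclotomicTower` they
give statement (A) in one call. -/

section Entry

variable {p : ℕ} [Fact p.Prime]

/-- **(A) from `p ∤ #Cl(ℚ(E[p]))`.**  `E/ℚ`, `p` odd, (c1) `p ∤ #Gal(ℚ(E[p])/ℚ)`,
`p ∤ #Cl(𝓞_{ℚ(E[p])})`, `κ` cyclotomic, (c3) at `p` in the `E[p^∞]`-currency («no non-zero `p`-torsion
point of `E[p^∞]` fixed by `D_p`», i.e. `E(ℚ_p)[p] = 0`) ⟹ statement (A) for `E` at `p`.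
[cite: CoatesSujatha2005, §3 Thm. 3.4 and Lemma 3.8]
[cite: DeoRaySujatha2023, §3 Thm. 3.9 (b), Example 3.10 (arXiv:2202.09937 p. 10)] -/
theorem conjA_of_not_dvd_card_classGroup
    (W : WeierstrassCurve ℚ) [W.IsElliptic] [NeZero p] (hp2 : p ≠ 2)
    [NumberField (W.divisionField p)]
    (hG : ¬ p ∣ Nat.card ((W.divisionField p) ≃ₐ[ℚ] (W.divisionField p)))
    (hh : ¬ p ∣ Nat.card (ClassGroup (𝓞 (W.divisionField p))))
    {κ : ZpExtension ℚ p} (hκ : κ.IsCyclotomic)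
    (hc3 : ∀ v : HeightOneSpectrum (𝓞 ℚ), ((p : ℕ) : 𝓞 ℚ) ∈ v.asIdeal →
      ∀ x : W.geomPrimaryTorsion p, p • x = 0 →
        (∀ d ∈ GreenbergSelmer.decomp v, d • x = x) → x = 0) :
    ∃ (γ : absoluteGaloisGroup ℚ) (D : W.FineSelmerDualData κ γ),
      Module.Finite ℤ_[p] (RestrictScalars ℤ_[p] (IwasawaAlgebra p) D.X) :=
  conjA_of_homTrivial_cyclotomicTower W hp2 hκ
    (DeoRaySujatha2023.homTrivial_divisionField_cyclotomicTower_of_not_dvd_classNumber W p hp2 hG hh hκ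
      hc3)

/-- **(A) from the eigen-test on `Cl(ℚ(P))`.**  `E/ℚ`, `p` odd, `E[p]` irreducible, (c1)
`p ∤ #Gal(ℚ(E[p])/ℚ)`, a subfield `K ⊆ ℚ(E[p])` whose absolute Galois group fixes a non-zero
`P ∈ E[p]` (`K = ℚ(P)`), the tautological eigen-test on `Cl(𝓞_K) ⊗ 𝔽_p` (every additive
`μ : Cl(𝓞_K) → ZMod p` with `μ([σ̄I]) = a • μ([I])` whenever `τ|_K = σ̄`, `τ • P = a • P`, is zero — a
fortiori when `p ∤ h(ℚ(P))`), `κ` cyclotomic, (c3) at `p` in the `E[p^∞]`-currency ⟹ statement (A).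
[cite: CoatesSujatha2005, §3 Thm. 3.4 and Lemma 3.8]
[cite: DeoRaySujatha2023, §3 Thm. 3.8 (c2) and the definition of H′_L (arXiv:2202.09937 p. 9)] -/
theorem conjA_of_eigenHom_subfield
    (W : WeierstrassCurve ℚ) [W.IsElliptic] [NeZero p] (hp2 : p ≠ 2)
    [NumberField (W.divisionField p)]
    (hirr : W.HasIrreducibleModPGaloisRep p)
    (hG : ¬ p ∣ Nat.card ((W.divisionField p) ≃ₐ[ℚ] (W.divisionField p)))
    (K : IntermediateField ℚ (W.divisionField p)) [NumberField K]
    (P : geomTorsion W (p : ℤ)) (hP0 : P ≠ 0)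
    (hPK : ∀ τ : absoluteGaloisGroup ℚ,
      (∀ x : K, absRestrictNormalHom (W.divisionField p) τ (x : W.divisionField p) = x) → τ • P = P)
    (hEig : ∀ μ : Additive (ClassGroup (𝓞 K)) →+ ZMod p,
      (∀ (τ : absoluteGaloisGroup ℚ) (σ : K ≃ₐ[ℚ] K) (a : ℕ),
          (∀ x : K, absRestrictNormalHom (W.divisionField p) τ (x : W.divisionField p) =
            ((σ x : K) : W.divisionField p)) → τ • P = a • P →
          ∀ (I J : (Ideal (𝓞 K))⁰),
            (J : Ideal (𝓞 K)) = (I : Ideal (𝓞 K)).map (AmbiguousClass.intAut σ : 𝓞 K →+* 𝓞 K) →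
            μ (Additive.ofMul (ClassGroup.mk0 J)) = a • μ (Additive.ofMul (ClassGroup.mk0 I))) →
      μ = 0)
    {κ : ZpExtension ℚ p} (hκ : κ.IsCyclotomic)
    (hc3 : ∀ v : HeightOneSpectrum (𝓞 ℚ), ((p : ℕ) : 𝓞 ℚ) ∈ v.asIdeal →
      ∀ x : W.geomPrimaryTorsion p, p • x = 0 →
        (∀ d ∈ GreenbergSelmer.decomp v, d • x = x) → x = 0) :
    ∃ (γ : absoluteGaloisGroup ℚ) (D : W.FineSelmerDualData κ γ),
      Module.Finite ℤ_[p] (RestrictScalars ℤ_[p] (IwasawaAlgebra p) D.X) :=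
  conjA_of_homTrivial_cyclotomicTower W hp2 hκ
    (DeoRaySujatha2023.homTrivial_divisionField_cyclotomicTower_of_eigenHom_subfield' W p hp2 hirr hG K
      P hP0 hPK hEig hκ hc3)

end Entry

end Literature.NumberTheory.EllipticCurves.CoatesSujatha2005

end
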